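import Summits.CriticalPhenomena.PercolationContinuityZ3.Theorems.SahiAESeparableTiltLowerSet

/-!
# The separable tilt — part 3/4: increasing differences a.e.; from the pair statement to coordinatewise and global monotonicity

Support file of the Sahi cell (`prim-sahi`): literature seat gen35's kernel file `SahiAESeparableTilt.lean`
(evidence n°8688 on `stmt-CriticalPhenomena-4575`, sha256 `af5f8450…be96`, 1048 lines), landed by a prover seat in FOUR
parts because tree `Theorems/` files are capped at 400 lines: `SahiAESeparableTiltPrelim`, `SahiAESeparableTiltLowerSet`,
`SahiAESeparableTiltCoord`, `SahiAESeparableTilt` (main theorems).  Every declaration is byte-identical to the evidence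
file and keeps its namespace `…Theorems.SahiAESeparableTilt`; only imports, module docstrings and the grouping of the
sections into files differ.  Theorems only (no definitions, no named facts, no sorries).

This part (sections `IncrDiff`, `Coord` of the evidence file):
* `ae_incrDiff_of_ae_supermodular` — increasing differences: for a.e. `(r,s)`, `r ≤ s`, `x ↦ D(r,s,x)` is
  non-decreasing on a.e. comparable pair (the a.e. hypothesis pulled back along the quasi-measure-preserving surgery
  `((r,s),(x,y)) ↦ (update x i s, update y i r)`; all pairs used are GENERIC — the a.e.-pair hypothesis is never
  instantiated at partially diagonal pairs such as `(x ∧ y, x)`).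
* `ae_coord_monotone_of_tilt` — the coordinatewise statement "`G(x) ≤ G(update x i s)` for a.e. `(x,s)`, `xᵢ ≤ s`":
  the diagonal substitution `r := xᵢ` is legitimate by the dummy-coordinate identity, because `D` does not read the
  `i`-th coordinate of its base point.
* `ae_monotone_of_ae_coord_monotone` — globalisation along the coordinate gluings `S.piecewise y x`
  (`measurePreserving_piecewise_pair_volume` of `SahiAECornerEnvelopePrelim.lean`).

Imports part 2 (`SahiAESeparableTiltLowerSet`); used by part 4 (`SahiAESeparableTilt`).
No sorries, no new axioms (`#print axioms`: propext, Classical.choice, Quot.sound).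
-/

noncomputable section

namespace Summit.CriticalPhenomena.PercolationContinuityZ3.Theorems.SahiAESeparableTilt

open MeasureTheory Set Filter Topology Metric Function
open Summit.CriticalPhenomena.PercolationContinuityZ3.Theorems.SahiAEFourFunctions
open scoped ENNReal NNReal

variable {ι : Type*} [Fintype ι]

/-! ### Increasing differences almost everywhere -/

section IncrDiff

variable [DecidableEq ι]

/-- **A.e. supermodularity ⟹ a.e. increasing differences in each coordinate.**  For `λ ⊗ λ`-almost every
`(r, s)` with `r ≤ s`, the increment `x ↦ φ(update x i s) − φ(update x i r)` is non-decreasing on `λ ⊗ λ`-almost every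
comparable pair `x ≤ y` (pull the hypothesis back along `((r,s),(x,y)) ↦ (update x i s, update y i r)`, a
quasi-measure-preserving map, and use `update x i s ⊓ update y i r = update x i r`, `⊔ = update y i s`). [this work] -/
theorem ae_incrDiff_of_ae_supermodular (i : ι) {φ : (ι → ℝ) → ℝ}
    (hsm : ∀ᵐ p ∂(volume : Measure (ι → ℝ)).prod volume, φ p.1 + φ p.2 ≤ φ (p.1 ⊓ p.2) + φ (p.1 ⊔ p.2)) :
    ∀ᵐ rs ∂(volume : Measure ℝ).prod (volume : Measure ℝ), rs.1 ≤ rs.2 →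
      ∀ᵐ p ∂(volume : Measure (ι → ℝ)).prod volume, p.1 ≤ p.2 →
        φ (update p.1 i rs.2) - φ (update p.1 i rs.1) ≤ φ (update p.2 i rs.2) - φ (update p.2 i rs.1) := by
  have hU := quasiMeasurePreserving_update (ι := ι) i
  have hΘ : Measure.QuasiMeasurePreserving
      (Prod.map (fun p : (ι → ℝ) × ℝ => update p.1 i p.2) (fun p : (ι → ℝ) × ℝ => update p.1 i p.2))
      (((volume : Measure (ι → ℝ)).prod (volume : Measure ℝ)).prod
        ((volume : Measure (ι → ℝ)).prod (volume : Measure ℝ)))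
      ((volume : Measure (ι → ℝ)).prod volume) := MeasureTheory.QuasiMeasurePreserving.prodMap hU hU
  have h1 := hΘ.ae hsm
  have hσ := measurePreserving_shuffle (volume : Measure ℝ) (volume : Measure ℝ) (volume : Measure (ι → ℝ))
    (volume : Measure (ι → ℝ))
  have h2 := hσ.quasiMeasurePreserving.ae h1
  have h3 : ∀ᵐ rs ∂(volume : Measure ℝ).prod (volume : Measure ℝ),
      ∀ᵐ p ∂(volume : Measure (ι → ℝ)).prod volume,
        φ (update p.1 i rs.1) + φ (update p.2 i rs.2) ≤
          φ (update p.1 i rs.1 ⊓ update p.2 i rs.2) + φ (update p.1 i rs.1 ⊔ update p.2 i rs.2) :=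
    Measure.ae_ae_of_ae_prod h2
  have h4 : ∀ᵐ rs ∂(volume : Measure ℝ).prod (volume : Measure ℝ), rs.2 ≤ rs.1 →
      ∀ᵐ p ∂(volume : Measure (ι → ℝ)).prod volume, p.1 ≤ p.2 →
        φ (update p.1 i rs.1) - φ (update p.1 i rs.2) ≤ φ (update p.2 i rs.1) - φ (update p.2 i rs.2) := by
    filter_upwards [h3] with rs hrs hle
    filter_upwards [hrs] with p hp hp12
    rw [update_inf_update_of_le hp12 hle i, update_sup_update_of_le hp12 hle i] at hp
    linarith
  have h5 := (Measure.measurePreserving_swap (μ := (volume : Measure ℝ))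
    (ν := (volume : Measure ℝ))).quasiMeasurePreserving.ae h4
  filter_upwards [h5] with rs hrs
  simpa only [Prod.fst_swap, Prod.snd_swap] using hrs

end IncrDiff

/-! ### From the pair statement to the coordinatewise statement, and from coordinatewise to global monotonicity -/

section Coord

variable [DecidableEq ι]

/-- **Per-coordinate monotonicity of the tilted function.**  If for almost every `(r, s)` with `r ≤ s` the bound
`a_i(s) − a_i(r) ≤ φ(update x i s) − φ(update x i r)` holds for almost every `x`, then
`G = φ − Σ_j a_j(x_j)` satisfies `G(x) ≤ G(update x i s)` for almost every `(x, s)` with `x_i ≤ s`.  The diagonal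
substitution `r := x_i` is legitimate by the dummy-coordinate identity (the increment does not read the `i`-th
coordinate of its base point). [this work] -/
theorem ae_coord_monotone_of_tilt {φ : (ι → ℝ) → ℝ} (hφ : Measurable φ) {a : ι → ℝ → ℝ}
    (ha : ∀ j, Measurable (a j)) (i : ι)
    (h : ∀ᵐ rs ∂(volume : Measure ℝ).prod (volume : Measure ℝ), ∀ᵐ x ∂(volume : Measure (ι → ℝ)),
      rs.1 ≤ rs.2 → a i rs.2 - a i rs.1 ≤ φ (update x i rs.2) - φ (update x i rs.1)) :
    ∀ᵐ q ∂(volume : Measure (ι → ℝ)).prod (volume : Measure ℝ),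
      q.1 i ≤ q.2 → φ q.1 - ∑ j, a j (q.1 j) ≤ φ (update q.1 i q.2) - ∑ j, a j (update q.1 i q.2 j) := by
  have hsum : ∀ (x : ι → ℝ) (s : ℝ), ∑ j, a j (update x i s j) - ∑ j, a j (x j) = a i s - a i (x i) := by
    intro x s
    rw [← Finset.sum_sub_distrib, Finset.sum_eq_single i]
    · rw [update_self]
    · intro j _ hj
      rw [update_of_ne hj, sub_self]
    · intro hi
      exact absurd (Finset.mem_univ i) hi
  suffices H : ∀ᵐ q ∂(volume : Measure (ι → ℝ)).prod (volume : Measure ℝ),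
      q.1 i ≤ q.2 → a i q.2 - a i (q.1 i) ≤ φ (update q.1 i q.2) - φ q.1 by
    filter_upwards [H] with q hq hle
    have h1 := hq hle
    have h2 := hsum q.1 q.2
    linarith
  -- measurable ingredients
  have mφu : Measurable fun q : (ι → ℝ) × ℝ => φ (update q.1 i q.2) := hφ.comp measurable_update'
  have mφ1 : Measurable fun q : (ι → ℝ) × ℝ => φ q.1 := hφ.comp measurable_fst
  have ma2 : Measurable fun q : (ι → ℝ) × ℝ => a i q.2 := (ha i).comp measurable_snd
  have ma1 : Measurable fun q : (ι → ℝ) × ℝ => a i (q.1 i) := (ha i).comp ((measurable_pi_apply i).comp measurable_fst)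
  -- the bad set
  set Bad : Set ((ι → ℝ) × ℝ) :=
    {q | q.1 i ≤ q.2 ∧ φ (update q.1 i q.2) - φ q.1 < a i q.2 - a i (q.1 i)} with hBad
  have mBad : MeasurableSet Bad :=
    (measurableSet_le ((measurable_pi_apply i).comp measurable_fst) measurable_snd).inter
      (measurableSet_lt (mφu.sub mφ1) (ma2.sub ma1))
  rw [ae_iff]
  have eBad : {q : (ι → ℝ) × ℝ | ¬(q.1 i ≤ q.2 → a i q.2 - a i (q.1 i) ≤ φ (update q.1 i q.2) - φ q.1)} = Bad := by
    ext q
    simp only [hBad, mem_setOf_eq, Classical.not_imp, not_le]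
  rw [eBad]
  -- the triple set and its nullity
  set T : Set ((ℝ × ℝ) × (ι → ℝ)) := {w | w.1.1 ≤ w.1.2 ∧
    φ (update w.2 i w.1.2) - φ (update w.2 i w.1.1) < a i w.1.2 - a i w.1.1} with hTdef
  have mT : MeasurableSet T := by
    have m1 : Measurable fun w : (ℝ × ℝ) × (ι → ℝ) => φ (update w.2 i w.1.2) :=
      hφ.comp (measurable_update'.comp (measurable_snd.prodMk (measurable_snd.comp measurable_fst)))
    have m2 : Measurable fun w : (ℝ × ℝ) × (ι → ℝ) => φ (update w.2 i w.1.1) :=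
      hφ.comp (measurable_update'.comp (measurable_snd.prodMk (measurable_fst.comp measurable_fst)))
    have m3 : Measurable fun w : (ℝ × ℝ) × (ι → ℝ) => a i w.1.2 := (ha i).comp (measurable_snd.comp measurable_fst)
    have m4 : Measurable fun w : (ℝ × ℝ) × (ι → ℝ) => a i w.1.1 := (ha i).comp (measurable_fst.comp measurable_fst)
    exact (measurableSet_le (measurable_fst.comp measurable_fst) (measurable_snd.comp measurable_fst)).inter
      (measurableSet_lt (m1.sub m2) (m3.sub m4))
  have hT0 : (((volume : Measure ℝ).prod (volume : Measure ℝ)).prod (volume : Measure (ι → ℝ))) T = 0 := by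
    have hae : ∀ᵐ w ∂((volume : Measure ℝ).prod (volume : Measure ℝ)).prod (volume : Measure (ι → ℝ)), w ∉ T := by
      rw [Measure.ae_prod_iff_ae_ae]
      · filter_upwards [h] with rs hrs
        filter_upwards [hrs] with x hx
        rintro ⟨hle, hlt⟩
        exact (not_le.2 hlt) (hx hle)
      · exact mT.compl
    exact measure_eq_zero_iff_ae_notMem.2 hae
  -- Fubini twice: `∫ x, ∫ r, vol{s : (update x i r, s) ∈ Bad} = (vol ⊗ vol ⊗ vol)(T) = 0`
  have hg : Measurable fun x : ι → ℝ => (volume : Measure ℝ) (Prod.mk x ⁻¹' Bad) :=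
    measurable_measure_prodMk_left mBad
  have hslice : ∀ (x : ι → ℝ) (r : ℝ), (volume : Measure ℝ) (Prod.mk (update x i r) ⁻¹' Bad) =
      (volume : Measure ℝ) (Prod.mk r ⁻¹' ((fun rs : ℝ × ℝ => (rs, x)) ⁻¹' T)) := by
    intro x r
    congr 1
    ext s
    simp only [hBad, hTdef, mem_preimage, mem_setOf_eq, update_self, update_idem]
  have hTx : ∀ x : ι → ℝ, MeasurableSet ((fun rs : ℝ × ℝ => (rs, x)) ⁻¹' T) := fun x =>
    measurable_prodMk_right mT
  have hint : ∫⁻ x, ∫⁻ r, (volume : Measure ℝ) (Prod.mk (update x i r) ⁻¹' Bad) ∂(volume : Measure ℝ)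
      ∂(volume : Measure (ι → ℝ)) = 0 := by
    have e1 : ∀ x : ι → ℝ, ∫⁻ r, (volume : Measure ℝ) (Prod.mk (update x i r) ⁻¹' Bad) ∂(volume : Measure ℝ) =
        ((volume : Measure ℝ).prod (volume : Measure ℝ)) ((fun rs : ℝ × ℝ => (rs, x)) ⁻¹' T) := by
      intro x
      simp_rw [hslice x]
      rw [← Measure.prod_apply (hTx x)]
    simp_rw [e1]
    rw [← Measure.prod_apply_symm mT, hT0]
  have hdummy := lintegral_lintegral_update i hg
  rw [hint] at hdummy
  have hBad0 : ∫⁻ x, (volume : Measure ℝ) (Prod.mk x ⁻¹' Bad) ∂(volume : Measure (ι → ℝ)) = 0 := by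
    rcases mul_eq_zero.1 hdummy.symm with h0 | h0
    · exact absurd h0 ENNReal.top_ne_zero
    · exact h0
  rw [Measure.prod_apply mBad, hBad0]

/-- Quasi-measure-preservation of `(x, y) ↦ (S.piecewise y x, y i)` for `i ∉ S` (a coordinate gluing followed by a
projection; `measurePreserving_piecewise_pair_volume`). [folklore] -/
theorem quasiMeasurePreserving_piecewise_eval (S : Finset ι) {i : ι} (hi : i ∉ S) :
    Measure.QuasiMeasurePreserving (fun p : (ι → ℝ) × (ι → ℝ) => (S.piecewise p.2 p.1, p.2 i))
      ((volume : Measure (ι → ℝ)).prod volume) ((volume : Measure (ι → ℝ)).prod (volume : Measure ℝ)) := by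
  have h1 : MeasurePreserving (fun p : (ι → ℝ) × (ι → ℝ) => (S.piecewise p.1 p.2, S.piecewise p.2 p.1))
      ((volume : Measure (ι → ℝ)).prod volume) ((volume : Measure (ι → ℝ)).prod volume) :=
    measurePreserving_piecewise_pair_volume S
  have h0 : MeasurePreserving (Prod.swap : (ι → ℝ) × (ι → ℝ) → (ι → ℝ) × (ι → ℝ))
      ((volume : Measure (ι → ℝ)).prod volume) ((volume : Measure (ι → ℝ)).prod volume) :=
    Measure.measurePreserving_swap
  have h2 : Measure.QuasiMeasurePreserving (Prod.map id fun y : ι → ℝ => y i)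
      ((volume : Measure (ι → ℝ)).prod volume) ((volume : Measure (ι → ℝ)).prod (volume : Measure ℝ)) :=
    MeasureTheory.QuasiMeasurePreserving.prodMap (Measure.QuasiMeasurePreserving.id _) (quasiMeasurePreserving_eval i)
  have e : (fun p : (ι → ℝ) × (ι → ℝ) => (S.piecewise p.2 p.1, p.2 i)) =
      (Prod.map id fun y : ι → ℝ => y i) ∘
        (fun p : (ι → ℝ) × (ι → ℝ) => (S.piecewise p.1 p.2, S.piecewise p.2 p.1)) ∘ Prod.swap := by
    funext p
    refine Prod.ext rfl ?_
    show p.2 i = S.piecewise p.1 p.2 i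
    exact (Finset.piecewise_eq_of_notMem _ _ _ hi).symm
  rw [e]
  exact (h2.comp h1.quasiMeasurePreserving).comp h0.quasiMeasurePreserving

/-- **From coordinatewise to global a.e. monotonicity**: if for every coordinate `i`, `G(x) ≤ G(update x i s)` for
almost every `(x, s)` with `x_i ≤ s`, then `G(x) ≤ G(y)` for almost every pair `x ≤ y` (induction along the
coordinate gluings `S.piecewise y x`). [this work] -/
theorem ae_monotone_of_ae_coord_monotone {G : (ι → ℝ) → ℝ}
    (h : ∀ i, ∀ᵐ q ∂(volume : Measure (ι → ℝ)).prod (volume : Measure ℝ),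
      q.1 i ≤ q.2 → G q.1 ≤ G (update q.1 i q.2)) :
    ∀ᵐ p ∂(volume : Measure (ι → ℝ)).prod volume, p.1 ≤ p.2 → G p.1 ≤ G p.2 := by
  suffices H : ∀ S : Finset ι, ∀ᵐ p ∂(volume : Measure (ι → ℝ)).prod volume,
      p.1 ≤ p.2 → G p.1 ≤ G (S.piecewise p.2 p.1) by
    filter_upwards [H Finset.univ] with p hp hle
    simpa only [Finset.piecewise_univ] using hp hle
  intro S
  induction S using Finset.induction_on with
  | empty =>
    exact Eventually.of_forall fun p _ => by simp only [Finset.piecewise_empty, le_refl]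
  | insert i S hi IH =>
    have hstep := (quasiMeasurePreserving_piecewise_eval S hi).ae (h i)
    filter_upwards [IH, hstep] with p hp hq hle
    rw [Finset.piecewise_insert]
    refine (hp hle).trans (hq ?_)
    show S.piecewise p.2 p.1 i ≤ p.2 i
    rw [Finset.piecewise_eq_of_notMem _ _ _ hi]
    exact hle i

end Coord

end Summit.CriticalPhenomena.PercolationContinuityZ3.Theorems.SahiAESeparableTilt

end
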